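import Mathlib

/-!
# The STEP CRITERION (sufficiency) for the static path model behind `KPlusLogSqLaw.TropicalB`

Cell pub-symmetroid, seat conjb-2 (g21). A helper toward the crux `TropicalB`
(`Summit.ValiantsHypothesis.ValiantsHypothesis.Theses.KPlusLogSqLaw.TropicalB`, item
`stmt-ValiantsHypothesis-19771`); it earns no crux credit and is not evidence for `MatrixDescartes` or for
Valiant's hypothesis.

Lines `S t θ = b t + s t * θ`; a window is separated at `θ` when its even-indexed lines lie strictly above its
odd-indexed lines at `θ`; a *step* at row `i` with reach `d` is the event «`[i, i+d]` separated somewhere,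
`[i+1, i+d+1]` separated somewhere, never both» (THEORY-NOTE-g21 §3). The companion file
`KPlusLogSqLawStepBetween` proves that a step (with `d` odd) forces an inner line of `[i+1, i+d]`, of the parity
opposite to the outer lines, whose slope lies strictly between the two outer slopes. This file proves the converse
for the SLOPES: given such an inner line, some choice of intercepts realises the step —

* `step_of_between_even` (`i` even, the inner line odd), `step_of_between_odd` (`i` odd, the inner line even).

So, for fixed slopes, «a step at row `i` with odd reach `d` is realisable by some intercepts» is EQUIVALENT to
«some inner line of the opposite parity has its slope strictly between `s i` and `s (i+d+1)`» — the STEP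
CRITERION of THEORY-NOTE-g21 §3.1bis, located beforehand as an exact law over the alphabet `{±1, ±2}` at reaches
3, 5, 7 (all 128 + 2048 + 32768 slope words, sampler `csrc/chainseq.c` of the cell deposit).

Construction: the inner line `o` and the two outer lines get intercept `0`, every other even line intercept `+M`,
every other odd line `-M`, with `M` exceeding twice every `|s t|` on the window; then `[i, i+d]` is separated at
`θ = -1` or `θ = +1` (according to the order of the outer slopes), `[i+1, i+d+1]` at the opposite point, and a
common separation point would put `θ` on both sides of `0` (the lines `i`, `o`, `i+d+1` are concurrent at `0`).
-/

set_option linter.dupNamespace false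

namespace Summit.ValiantsHypothesis.ValiantsHypothesis.Theorems.KPlusLogSqLawStepOfBetween

open Finset

/-- Core construction, for an arbitrary class `up` of upper lines (decidable), outer lines `i`, `i+d+1` upper,
inner line `o` not upper with `s i < s o < s (i+d+1)`: intercepts realising a step, with `[i, i+d]` separated at
`-1` and `[i+1, i+d+1]` at `+1`. -/
theorem step_of_between_core (up : ℕ → Prop) [DecidablePred up] (s : ℕ → ℝ) (i d o : ℕ) (hup0 : up i)
    (hup1 : up (i + d + 1)) (hou : ¬ up o) (h1 : i + 1 ≤ o) (h2 : o ≤ i + d) (hs1 : s i < s o)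
    (hs2 : s o < s (i + d + 1)) :
    ∃ b : ℕ → ℝ,
      (∀ e o' : ℕ, i ≤ e → e ≤ i + d → i ≤ o' → o' ≤ i + d → up e → ¬ up o' →
        b o' + s o' * (-1) < b e + s e * (-1)) ∧
      (∀ e o' : ℕ, i + 1 ≤ e → e ≤ i + d + 1 → i + 1 ≤ o' → o' ≤ i + d + 1 → up e → ¬ up o' →
        b o' + s o' * 1 < b e + s e * 1) ∧
      (∀ θ : ℝ, ¬ ((∀ e o' : ℕ, i ≤ e → e ≤ i + d → i ≤ o' → o' ≤ i + d → up e → ¬ up o' →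
        b o' + s o' * θ < b e + s e * θ) ∧ (∀ e o' : ℕ, i + 1 ≤ e → e ≤ i + d + 1 → i + 1 ≤ o' → o' ≤ i + d + 1 →
        up e → ¬ up o' → b o' + s o' * θ < b e + s e * θ))) := by
  -- a bound for the slopes on the window
  set M : ℝ := 1 + 2 * ∑ t ∈ Finset.range (i + d + 2), |s t| with hM
  have hbound : ∀ t : ℕ, t ≤ i + d + 1 → 2 * |s t| + 1 ≤ M := by
    intro t ht
    have := Finset.single_le_sum (f := fun t => |s t|) (fun t _ => abs_nonneg (s t))
      (Finset.mem_range.mpr (show t < i + d + 2 by omega))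
    linarith
  have hoi : o ≠ i := fun h => hou (h ▸ hup0)
  have hotop : o ≠ i + d + 1 := fun h => hou (h ▸ hup1)
  -- the intercepts
  refine ⟨fun t => if t = i ∨ t = o ∨ t = i + d + 1 then 0 else if up t then M else -M, ?_, ?_, ?_⟩
  · -- `[i, i+d]` separated at `-1`
    intro e o' g1 g2 g3 g4 he ho'
    have ho'i : o' ≠ i := fun h => ho' (h ▸ hup0)
    have ho'top : o' ≠ i + d + 1 := by omega
    have hetop : e ≠ i + d + 1 := by omega
    have heo : e ≠ o := fun h => hou (h ▸ he)
    have ae := le_abs_self (s e)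
    have ae' := neg_abs_le (s e)
    have ao := le_abs_self (s o')
    have ao' := neg_abs_le (s o')
    have be := hbound e (by omega)
    have bo := hbound o' (by omega)
    by_cases hei : e = i
    · subst hei
      by_cases hoo : o' = o
      · subst hoo
        simp only [true_or, or_true, if_true]
        linarith
      · have hsel : ¬ (o' = e ∨ o' = o ∨ o' = e + d + 1) := by
          rintro (h | h | h)
          · exact ho'i h
          · exact hoo h
          · exact ho'top h
        simp only [true_or, if_true, if_neg hsel, if_neg ho']
        linarith
    · have hsele : ¬ (e = i ∨ e = o ∨ e = i + d + 1) := by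
        rintro (h | h | h)
        · exact hei h
        · exact heo h
        · exact hetop h
      by_cases hoo : o' = o
      · subst hoo
        simp only [true_or, or_true, if_true, if_neg hsele, if_pos he]
        linarith
      · have hsel : ¬ (o' = i ∨ o' = o ∨ o' = i + d + 1) := by
          rintro (h | h | h)
          · exact ho'i h
          · exact hoo h
          · exact ho'top h
        simp only [if_neg hsele, if_pos he, if_neg hsel, if_neg ho']
        linarith
  · -- `[i+1, i+d+1]` separated at `+1`
    intro e o' g1 g2 g3 g4 he ho'
    have ho'i : o' ≠ i := by omega
    have ho'top : o' ≠ i + d + 1 := fun h => ho' (h ▸ hup1)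
    have hei : e ≠ i := by omega
    have heo : e ≠ o := fun h => hou (h ▸ he)
    have ae := le_abs_self (s e)
    have ae' := neg_abs_le (s e)
    have ao := le_abs_self (s o')
    have ao' := neg_abs_le (s o')
    have be := hbound e (by omega)
    have bo := hbound o' (by omega)
    by_cases hetop : e = i + d + 1
    · subst hetop
      by_cases hoo : o' = o
      · subst hoo
        simp only [true_or, or_true, if_true]
        linarith
      · have hsel : ¬ (o' = i ∨ o' = o ∨ o' = i + d + 1) := by
          rintro (h | h | h)
          · exact ho'i h
          · exact hoo h
          · exact ho'top h
        simp only [or_true, if_true, if_neg hsel, if_neg ho']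
        linarith
    · have hsele : ¬ (e = i ∨ e = o ∨ e = i + d + 1) := by
        rintro (h | h | h)
        · exact hei h
        · exact heo h
        · exact hetop h
      by_cases hoo : o' = o
      · subst hoo
        simp only [true_or, or_true, if_true, if_neg hsele, if_pos he]
        linarith
      · have hsel : ¬ (o' = i ∨ o' = o ∨ o' = i + d + 1) := by
          rintro (h | h | h)
          · exact ho'i h
          · exact hoo h
          · exact ho'top h
        simp only [if_neg hsele, if_pos he, if_neg hsel, if_neg ho']
        linarith
  · -- never both: the comparisons `(i, o)` and `(i+d+1, o)` put `θ` on both sides of `0`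
    intro θ hθ
    have hA := hθ.1 i o (le_refl _) (by omega) (by omega) h2 hup0 hou
    have hB := hθ.2 (i + d + 1) o (by omega) (le_refl _) h1 (by omega) hup1 hou
    simp only [true_or, or_true, if_true] at hA hB
    -- hA : s o * θ < s i * θ ;  hB : s o * θ < s (i+d+1) * θ  (up to `0 +`)
    have hneg : θ < 0 := by
      by_contra hc
      have hc' : 0 ≤ θ := not_lt.mp hc
      have := mul_nonneg (show 0 ≤ s o - s i by linarith) hc'
      nlinarith
    have hpos : 0 < θ := by
      by_contra hc
      have hc' : θ ≤ 0 := not_lt.mp hc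
      have := mul_nonneg (show 0 ≤ s (i + d + 1) - s o by linarith) (show 0 ≤ -θ by linarith)
      nlinarith
    linarith

/-- STEP CRITERION, sufficiency, even first line: `i` even, `d` odd, an odd line `o` of `[i+1, i+d]` with slope
strictly between `s i` and `s (i+d+1)` ⇒ some intercepts realise a step from `[i, i+d]` to `[i+1, i+d+1]`. -/
theorem step_of_between_even (s : ℕ → ℝ) (i d o : ℕ) (hi : Even i) (hd : Odd d) (ho : Odd o)
    (h1 : i + 1 ≤ o) (h2 : o ≤ i + d)
    (hs : (s i < s o ∧ s o < s (i + d + 1)) ∨ (s (i + d + 1) < s o ∧ s o < s i)) :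
    ∃ b : ℕ → ℝ,
      (∃ θ : ℝ, ∀ e o' : ℕ, i ≤ e → e ≤ i + d → i ≤ o' → o' ≤ i + d → Even e → Odd o' →
        b o' + s o' * θ < b e + s e * θ) ∧
      (∃ θ : ℝ, ∀ e o' : ℕ, i + 1 ≤ e → e ≤ i + d + 1 → i + 1 ≤ o' → o' ≤ i + d + 1 → Even e → Odd o' →
        b o' + s o' * θ < b e + s e * θ) ∧
      (∀ θ : ℝ, ¬ ((∀ e o' : ℕ, i ≤ e → e ≤ i + d → i ≤ o' → o' ≤ i + d → Even e → Odd o' →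
        b o' + s o' * θ < b e + s e * θ) ∧ (∀ e o' : ℕ, i + 1 ≤ e → e ≤ i + d + 1 → i + 1 ≤ o' → o' ≤ i + d + 1 →
        Even e → Odd o' → b o' + s o' * θ < b e + s e * θ))) := by
  have hi2 := Nat.even_iff.mp hi
  have hd2 := Nat.odd_iff.mp hd
  have hup1 : Even (i + d + 1) := Nat.even_iff.mpr (by omega)
  have hou : ¬ Even o := Nat.not_even_iff_odd.mpr ho
  rcases hs with ⟨hs1, hs2⟩ | ⟨hs1, hs2⟩
  · obtain ⟨b, hA, hB, hAB⟩ := step_of_between_core (fun n => Even n) s i d o hi hup1 hou h1 h2 hs1 hs2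
    refine ⟨b, ⟨-1, fun e o' g1 g2 g3 g4 he ho' => hA e o' g1 g2 g3 g4 he (Nat.not_even_iff_odd.mpr ho')⟩,
      ⟨1, fun e o' g1 g2 g3 g4 he ho' => hB e o' g1 g2 g3 g4 he (Nat.not_even_iff_odd.mpr ho')⟩, ?_⟩
    intro θ hθ
    exact hAB θ ⟨fun e o' g1 g2 g3 g4 he ho' => hθ.1 e o' g1 g2 g3 g4 he (Nat.not_even_iff_odd.mp ho'),
      fun e o' g1 g2 g3 g4 he ho' => hθ.2 e o' g1 g2 g3 g4 he (Nat.not_even_iff_odd.mp ho')⟩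
  · -- reflected slopes `-s`, then `θ ↦ -θ`
    set s' : ℕ → ℝ := fun t => - s t with hs'
    have hs'v : ∀ t, s' t = - s t := fun t => rfl
    obtain ⟨b, hA, hB, hAB⟩ := step_of_between_core (fun n => Even n) s' i d o hi hup1 hou h1 h2
      (by rw [hs'v, hs'v]; linarith) (by rw [hs'v, hs'v]; linarith)
    refine ⟨b, ⟨1, fun e o' g1 g2 g3 g4 he ho' => ?_⟩, ⟨-1, fun e o' g1 g2 g3 g4 he ho' => ?_⟩, ?_⟩
    · have := hA e o' g1 g2 g3 g4 he (Nat.not_even_iff_odd.mpr ho')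
      linarith [hs'v e, hs'v o']
    · have := hB e o' g1 g2 g3 g4 he (Nat.not_even_iff_odd.mpr ho')
      linarith [hs'v e, hs'v o']
    · intro θ hθ
      apply hAB (-θ)
      constructor
      · intro e o' g1 g2 g3 g4 he ho'
        have := hθ.1 e o' g1 g2 g3 g4 he (Nat.not_even_iff_odd.mp ho')
        have r1 : s' o' * (-θ) = s o' * θ := by rw [hs'v]; ring
        have r2 : s' e * (-θ) = s e * θ := by rw [hs'v]; ring
        linarith
      · intro e o' g1 g2 g3 g4 he ho'
        have := hθ.2 e o' g1 g2 g3 g4 he (Nat.not_even_iff_odd.mp ho')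
        have r1 : s' o' * (-θ) = s o' * θ := by rw [hs'v]; ring
        have r2 : s' e * (-θ) = s e * θ := by rw [hs'v]; ring
        linarith

/-- STEP CRITERION, sufficiency, odd first line: `i` odd, `d` odd, an even line `e` of `[i+1, i+d]` with slope
strictly between `s i` and `s (i+d+1)` ⇒ some intercepts realise a step from `[i, i+d]` to `[i+1, i+d+1]`. -/
theorem step_of_between_odd (s : ℕ → ℝ) (i d e : ℕ) (hi : Odd i) (hd : Odd d) (he : Even e)
    (h1 : i + 1 ≤ e) (h2 : e ≤ i + d)
    (hs : (s (i + d + 1) < s e ∧ s e < s i) ∨ (s i < s e ∧ s e < s (i + d + 1))) :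
    ∃ b : ℕ → ℝ,
      (∃ θ : ℝ, ∀ e' o : ℕ, i ≤ e' → e' ≤ i + d → i ≤ o → o ≤ i + d → Even e' → Odd o →
        b o + s o * θ < b e' + s e' * θ) ∧
      (∃ θ : ℝ, ∀ e' o : ℕ, i + 1 ≤ e' → e' ≤ i + d + 1 → i + 1 ≤ o → o ≤ i + d + 1 → Even e' → Odd o →
        b o + s o * θ < b e' + s e' * θ) ∧
      (∀ θ : ℝ, ¬ ((∀ e' o : ℕ, i ≤ e' → e' ≤ i + d → i ≤ o → o ≤ i + d → Even e' → Odd o →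
        b o + s o * θ < b e' + s e' * θ) ∧ (∀ e' o : ℕ, i + 1 ≤ e' → e' ≤ i + d + 1 → i + 1 ≤ o → o ≤ i + d + 1 →
        Even e' → Odd o → b o + s o * θ < b e' + s e' * θ))) := by
  have hi2 := Nat.odd_iff.mp hi
  have hd2 := Nat.odd_iff.mp hd
  have hup1 : Odd (i + d + 1) := Nat.odd_iff.mpr (by omega)
  have heu : ¬ Odd e := Nat.not_odd_iff_even.mpr he
  rcases hs with ⟨hs1, hs2⟩ | ⟨hs1, hs2⟩
  · -- negated lines `-S t` with upper class `Odd`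
    set s' : ℕ → ℝ := fun t => - s t with hs'
    have hs'v : ∀ t, s' t = - s t := fun t => rfl
    obtain ⟨b, hA, hB, hAB⟩ := step_of_between_core (fun n => Odd n) s' i d e hi hup1 heu h1 h2
      (by rw [hs'v, hs'v]; linarith) (by rw [hs'v, hs'v]; linarith)
    set b' : ℕ → ℝ := fun t => - b t with hb'
    have hb'v : ∀ t, b' t = - b t := fun t => rfl
    refine ⟨b', ⟨-1, fun e' o g1 g2 g3 g4 he' ho => ?_⟩, ⟨1, fun e' o g1 g2 g3 g4 he' ho => ?_⟩, ?_⟩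
    · have := hA o e' g3 g4 g1 g2 ho (Nat.not_odd_iff_even.mpr he')
      linarith [hs'v e', hs'v o, hb'v e', hb'v o]
    · have := hB o e' g3 g4 g1 g2 ho (Nat.not_odd_iff_even.mpr he')
      linarith [hs'v e', hs'v o, hb'v e', hb'v o]
    · intro θ hθ
      apply hAB θ
      constructor
      · intro o e' g1 g2 g3 g4 ho he'
        have := hθ.1 e' o g3 g4 g1 g2 (Nat.not_odd_iff_even.mp he') ho
        have r1 : s' o * θ = -(s o * θ) := by rw [hs'v]; ring
        have r2 : s' e' * θ = -(s e' * θ) := by rw [hs'v]; ring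
        linarith [hb'v e', hb'v o]
      · intro o e' g1 g2 g3 g4 ho he'
        have := hθ.2 e' o g3 g4 g1 g2 (Nat.not_odd_iff_even.mp he') ho
        have r1 : s' o * θ = -(s o * θ) := by rw [hs'v]; ring
        have r2 : s' e' * θ = -(s e' * θ) := by rw [hs'v]; ring
        linarith [hb'v e', hb'v o]
  · -- negated lines and `θ ↦ -θ`: slopes back to `s`, intercepts negated
    obtain ⟨b, hA, hB, hAB⟩ := step_of_between_core (fun n => Odd n) s i d e hi hup1 heu h1 h2 hs1 hs2
    set b' : ℕ → ℝ := fun t => - b t with hb'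
    have hb'v : ∀ t, b' t = - b t := fun t => rfl
    refine ⟨b', ⟨1, fun e' o g1 g2 g3 g4 he' ho => ?_⟩, ⟨-1, fun e' o g1 g2 g3 g4 he' ho => ?_⟩, ?_⟩
    · have := hA o e' g3 g4 g1 g2 ho (Nat.not_odd_iff_even.mpr he')
      linarith [hb'v e', hb'v o]
    · have := hB o e' g3 g4 g1 g2 ho (Nat.not_odd_iff_even.mpr he')
      linarith [hb'v e', hb'v o]
    · intro θ hθ
      apply hAB (-θ)
      constructor
      · intro o e' g1 g2 g3 g4 ho he'
        have := hθ.1 e' o g3 g4 g1 g2 (Nat.not_odd_iff_even.mp he') ho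
        have r1 : s o * (-θ) = -(s o * θ) := by ring
        have r2 : s e' * (-θ) = -(s e' * θ) := by ring
        linarith [hb'v e', hb'v o]
      · intro o e' g1 g2 g3 g4 ho he'
        have := hθ.2 e' o g3 g4 g1 g2 (Nat.not_odd_iff_even.mp he') ho
        have r1 : s o * (-θ) = -(s o * θ) := by ring
        have r2 : s e' * (-θ) = -(s e' * θ) := by ring
        linarith [hb'v e', hb'v o]

end Summit.ValiantsHypothesis.ValiantsHypothesis.Theorems.KPlusLogSqLawStepOfBetween
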